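import Literature.Probability.Percolation.SlabRSWGluingCrossSurgery
import HarnessLib

/-!
# Newman–Tassion–Wu 2017, §3.2 (Remark 2) — the plain surgery near an inner corner when the far
# path enters the cleared box through the notch

Topic: `Literature/Probability/Percolation`. Complement of `GlueData.exists_surgery_cross`: there the
port's neighbour `w'` (the first vertex of the far path over the cleared box `D`) lies over the
cross `Λ = D ∩ S`; near an inner corner of a rectilinear domain it may instead lie over the NOTCH
`D ∖ S` (the missing quadrant). Since no vertex of `Γ ⊆ S̄` and no vertex of the route lies over the
notch, `w'` is joined through the notch to an entry vertex over `Λ` whose cell avoids the two ends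
`E₁, E₂` of `Γ` over `D` (three candidate entries when the notch has three rows or three columns along
a bar), and the route of `exists_route_cross` is extended along that chain
(`RouteSpec.append_branch`): `GlueData.exists_surgery_cross_notch`.

## Sources

* C. M. Newman, V. Tassion, W. Wu, *Critical percolation and the minimal spanning tree in slabs*,
  Comm. Pure Appl. Math. 70 (2017), arXiv:1512.09107: §3.2, proof of Theorem 3.7, steps (1)–(3),
  Remark 2 (rectilinear domains) [NewmanTassionWu2017].
-/

noncomputable section

namespace Literature.Probability.Percolation

open LatticeModels SimpleGraph

namespace NTW17

variable {k : ℕ}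

/-- A free target among three candidates avoiding two forbidden values. [folklore] -/
private theorem exists_free_of_three' {a : ℤ} (f₁ f₂ : ℤ) : ∃ x, a ≤ x ∧ x ≤ a + 2 ∧ x ≠ f₁ ∧ x ≠ f₂ := by
  by_cases h0 : a ≠ f₁ ∧ a ≠ f₂
  · exact ⟨a, le_rfl, by omega, h0.1, h0.2⟩
  by_cases h1 : a + 1 ≠ f₁ ∧ a + 1 ≠ f₂
  · exact ⟨a + 1, by omega, by omega, h1.1, h1.2⟩
  refine ⟨a + 2, by omega, le_rfl, ?_, ?_⟩ <;> omega

/-- The lift of a planar `PPath` at height `h ≤ k`, extended by one lattice step off the path, is a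
slab path; its other vertices lie over the planar path. [folklore] -/
private theorem feeder_of_ppath' {l : List (ℤ × ℤ)} {s m : ℤ × ℤ} (hl : PPath l s m) {h : ℕ} (hh : h ≤ k)
    {e : ℤ × ℤ} (hadj : planarAdj m e) (he : e ∉ l) :
    SPath (liftH k h l ++ [vtx k e h]) (vtx k s h) (vtx k e h) ∧
      ∀ v ∈ liftH k h l ++ [vtx k e h], v ≠ vtx k e h → planar k v ∈ l := by
  have hX := liftH_spath (k := k) hl h
  have heX : vtx k e h ∉ liftH k h l := by
    intro hm
    rw [mem_liftH_iff hh, planar_vtx] at hm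
    exact he hm.1
  refine ⟨hX.concat (vtx_adj_vtx_planar hadj h) heX, fun v hv hne => ?_⟩
  rcases List.mem_append.1 hv with hv | hv
  · rw [mem_liftH_iff hh] at hv; exact hv.1
  · exact absurd (List.mem_singleton.1 hv) hne

/-- **A chain through the notch.** Let `Nq = [n₁,n₂] × [m₁,m₂]` be a rectangle (the notch) and `w'` a
vertex over it. If `Nq` has at least three rows and the column `xe` is adjacent to it
(`xe = n₁ - 1` or `xe = n₂ + 1`), then for any two cells `f₁, f₂` there are an entry vertex `e` over
`{xe} × [m₁,m₂]` off `f₁, f₂`, at the height of `w'`, and a self-avoiding lattice chain `X` from next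
to `e` to `w'` inside `N̄q` (`(e :: X)` a chain, `X.getLast = w'`). [folklore] -/
private theorem exists_notch_chain_col {n₁ n₂ m₁ m₂ xe : ℤ} (hm : m₁ + 2 ≤ m₂) (hn : n₁ ≤ n₂)
    (hxe : xe = n₁ - 1 ∨ xe = n₂ + 1) {w' : slab 3 k} (hw' : planar k w' ∈ boxR n₁ n₂ m₁ m₂)
    (f₁ f₂ : ℤ × ℤ) :
    ∃ (e : slab 3 k) (X : List (slab 3 k)) (hX : X ≠ []), (planar k e).1 = xe ∧ m₁ ≤ (planar k e).2 ∧
      (planar k e).2 ≤ m₂ ∧ planar k e ≠ f₁ ∧ planar k e ≠ f₂ ∧ ht e = ht w' ∧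
      (e :: X).IsChain (fun a b => (slabGraph 3 k).Adj a b) ∧ X.Nodup ∧ X.getLast hX = w' ∧
      ∀ x ∈ X, planar k x ∈ boxR n₁ n₂ m₁ m₂ := by
  rw [mem_boxR_iff] at hw'
  obtain ⟨ys, hys1, hys2, hf₁, hf₂⟩ := exists_free_of_three' (a := m₁)
    (if f₁.1 = xe then f₁.2 else m₁ - 1) (if f₂.1 = xe then f₂.2 else m₁ - 1)
  -- the boundary cell of the notch next to the entry
  set xb : ℤ := if xe = n₁ - 1 then n₁ else n₂ with hxb
  have hxb1 : n₁ ≤ xb ∧ xb ≤ n₂ := by rw [hxb]; split_ifs <;> omega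
  have hadj_be : planarAdj (xb, ys) (xe, ys) := by
    rcases hxe with h | h
    · rw [hxb, if_pos h, h]
      exact Or.inl (Or.inr (by ext <;> simp))
    · have hne : ¬xe = n₁ - 1 := by omega
      rw [hxb, if_neg hne, h]; exact Or.inl (Or.inl (by ext <;> simp))
  -- planar path inside the notch from `planar w'` to the boundary cell (vertical leg first)
  obtain ⟨l, hl, hlmem⟩ := exists_lpath_vh (planar k w') (xb, ys)
  have hlN : ∀ z ∈ l, z ∈ boxR n₁ n₂ m₁ m₂ := by
    intro z hz
    rw [mem_boxR_iff]
    rcases (hlmem z).1 hz with ⟨h1, h2, h3⟩ | ⟨h1, h2, h3⟩ <;> simp only at h1 h2 h3 <;>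
      rw [min_def] at h2 <;> rw [max_def] at h3 <;> split_ifs at h2 h3 <;> omega
  have heN : ((xe, ys) : ℤ × ℤ) ∉ l := by
    intro h; have := hlN _ h; rw [mem_boxR_iff] at this; simp only at this; omega
  obtain ⟨hF, hmem⟩ := feeder_of_ppath' (k := k) hl (ht_le w') hadj_be heN
  -- package: `F = liftH l ++ [e]` runs from `w'` to `e`; reverse it
  set e : slab 3 k := vtx k (xe, ys) (ht w') with hedef
  have hte : w' ≠ e := by
    intro h; have := congrArg (fun v => (planar k v).1) h
    simp only [hedef, planar_vtx] at this; omega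
  rw [vtx_planar_ht] at hF
  obtain ⟨X, hFX⟩ := exists_eq_append_of_getLast? hF.last
  have hXne : X ≠ [] := by
    rintro rfl
    have := hF.head; rw [hFX] at this
    simp only [List.nil_append, List.head?_cons, Option.some.injEq] at this
    exact hte this.symm
  have hnd : (X ++ [e]).Nodup := hFX ▸ hF.nodup
  have hXhead : X.head hXne = w' := by
    have := hF.head
    rw [hFX, List.head?_append_of_ne_nil _ hXne, List.head?_eq_some_head hXne, Option.some.injEq] at this
    exact this
  have hchr : (e :: X.reverse).IsChain (fun a b => (slabGraph 3 k).Adj a b) := by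
    have := hF.reverse.chain
    rw [hFX, List.reverse_append] at this
    simpa using this
  refine ⟨e, X.reverse, by simpa using hXne, by simp [hedef, planar_vtx], by simp [hedef, planar_vtx]; omega,
    by simp [hedef, planar_vtx]; omega, ?_, ?_, by rw [hedef, ht_vtx (ht_le w')], hchr,
    List.nodup_reverse.2 hnd.of_append_left, by rw [List.getLast_reverse]; exact hXhead, fun x hx => ?_⟩
  · rw [hedef, planar_vtx]; intro h; rw [← h] at hf₁; simp at hf₁
  · rw [hedef, planar_vtx]; intro h; rw [← h] at hf₂; simp at hf₂
  · have hxF : x ∈ liftH k (ht w') l ++ [vtx k (xe, ys) (ht w')] := by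
      rw [hFX]; exact List.mem_append_left _ (List.mem_reverse.1 hx)
    have hxe : x ≠ vtx k (xe, ys) (ht w') := by
      intro h
      exact (List.disjoint_of_nodup_append hnd) (List.mem_reverse.1 hx) (by simp [hedef, h])
    exact hlN _ (hmem x hxF hxe)

/-- **A chain through the notch, entering through a row** (the transposed form: the notch has at
least three columns and the row `ye` is adjacent to it). [folklore] -/
private theorem exists_notch_chain_row {n₁ n₂ m₁ m₂ ye : ℤ} (hn : n₁ + 2 ≤ n₂) (hm : m₁ ≤ m₂)
    (hye : ye = m₁ - 1 ∨ ye = m₂ + 1) {w' : slab 3 k} (hw' : planar k w' ∈ boxR n₁ n₂ m₁ m₂)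
    (f₁ f₂ : ℤ × ℤ) :
    ∃ (e : slab 3 k) (X : List (slab 3 k)) (hX : X ≠ []), (planar k e).2 = ye ∧ n₁ ≤ (planar k e).1 ∧
      (planar k e).1 ≤ n₂ ∧ planar k e ≠ f₁ ∧ planar k e ≠ f₂ ∧ ht e = ht w' ∧
      (e :: X).IsChain (fun a b => (slabGraph 3 k).Adj a b) ∧ X.Nodup ∧ X.getLast hX = w' ∧
      ∀ x ∈ X, planar k x ∈ boxR n₁ n₂ m₁ m₂ := by
  rw [mem_boxR_iff] at hw'
  obtain ⟨xs, hxs1, hxs2, hf₁, hf₂⟩ := exists_free_of_three' (a := n₁)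
    (if f₁.2 = ye then f₁.1 else n₁ - 1) (if f₂.2 = ye then f₂.1 else n₁ - 1)
  set yb : ℤ := if ye = m₁ - 1 then m₁ else m₂ with hyb
  have hyb1 : m₁ ≤ yb ∧ yb ≤ m₂ := by rw [hyb]; split_ifs <;> omega
  have hadj_be : planarAdj (xs, yb) (xs, ye) := by
    rcases hye with h | h
    · rw [hyb, if_pos h, h]
      exact Or.inr (Or.inr (by ext <;> simp))
    · have hne : ¬ye = m₁ - 1 := by omega
      rw [hyb, if_neg hne, h]; exact Or.inr (Or.inl (by ext <;> simp))
  obtain ⟨l, hl, hlmem⟩ := exists_lpath_hv (planar k w') (xs, yb)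
  have hlN : ∀ z ∈ l, z ∈ boxR n₁ n₂ m₁ m₂ := by
    intro z hz
    rw [mem_boxR_iff]
    rcases (hlmem z).1 hz with ⟨h1, h2, h3⟩ | ⟨h1, h2, h3⟩ <;> simp only at h1 h2 h3 <;>
      rw [min_def] at h2 <;> rw [max_def] at h3 <;> split_ifs at h2 h3 <;> omega
  have heN : ((xs, ye) : ℤ × ℤ) ∉ l := by
    intro h; have := hlN _ h; rw [mem_boxR_iff] at this; simp only at this; omega
  obtain ⟨hF, hmem⟩ := feeder_of_ppath' (k := k) hl (ht_le w') hadj_be heN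
  set e : slab 3 k := vtx k (xs, ye) (ht w') with hedef
  have hte : w' ≠ e := by
    intro h; have := congrArg (fun v => (planar k v).2) h
    simp only [hedef, planar_vtx] at this; omega
  rw [vtx_planar_ht] at hF
  obtain ⟨X, hFX⟩ := exists_eq_append_of_getLast? hF.last
  have hXne : X ≠ [] := by
    rintro rfl
    have := hF.head; rw [hFX] at this
    simp only [List.nil_append, List.head?_cons, Option.some.injEq] at this
    exact hte this.symm
  have hnd : (X ++ [e]).Nodup := hFX ▸ hF.nodup
  have hXhead : X.head hXne = w' := by
    have := hF.head
    rw [hFX, List.head?_append_of_ne_nil _ hXne, List.head?_eq_some_head hXne, Option.some.injEq] at this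
    exact this
  have hchr : (e :: X.reverse).IsChain (fun a b => (slabGraph 3 k).Adj a b) := by
    have := hF.reverse.chain
    rw [hFX, List.reverse_append] at this
    simpa using this
  refine ⟨e, X.reverse, by simpa using hXne, by simp [hedef, planar_vtx], by simp [hedef, planar_vtx]; omega,
    by simp [hedef, planar_vtx]; omega, ?_, ?_, by rw [hedef, ht_vtx (ht_le w')], hchr,
    List.nodup_reverse.2 hnd.of_append_left, by rw [List.getLast_reverse]; exact hXhead, fun x hx => ?_⟩
  · rw [hedef, planar_vtx]; intro h; rw [← h] at hf₁; simp at hf₁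
  · rw [hedef, planar_vtx]; intro h; rw [← h] at hf₂; simp at hf₂
  · have hxF : x ∈ liftH k (ht w') l ++ [vtx k (xs, ye) (ht w')] := by
      rw [hFX]; exact List.mem_append_left _ (List.mem_reverse.1 hx)
    have hxe : x ≠ vtx k (xs, ye) (ht w') := by
      intro h
      exact (List.disjoint_of_nodup_append hnd) (List.mem_reverse.1 hx) (by simp [hedef, h])
    exact hlN _ (hmem x hxF hxe)

namespace GlueData

variable {Q : GlueData} {ω : BondConfig (slab 3 k)}

/-- **The plain surgery near an inner corner, far path entering through the notch.** As in
`exists_surgery_cross` (cleared set `D ⊆ R` off `A, B`; cross `Λ = A' ∪ B' ⊆ S ∩ D` carrying every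
vertex of `Γ` over `D`, two of them distinct; port `q₁ ∉ D̄` next to `w'`, joined to `C̄` in `(R ∖ D)‾`),
but now `w'` lies over a rectangle `Nq ⊆ D` disjoint from `Λ` (the notch) adjacent to the cross
along one of its bars: either `Nq` has at least three rows, lies in the rows of `A'`, and one of the
columns `xL - 1 = n₂`, `xR + 1 = n₁` bounds it; or it has at least three columns, lies in the columns
of `B'`, and one of the rows `rB - 1 = m₂`, `rT + 1 = m₁` bounds it. Then there is a surgery with
cleared set `D`. [cite: NewmanTassionWu2017, §3.2 (proof of Theorem 3.7, steps (1)–(3); Remark 2)] -/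
theorem exists_surgery_cross_notch (hk : 1 ≤ k) (hX : ω ∈ Q.evX k) {D : Set (ℤ × ℤ)}
    (hDR : D ⊆ Q.R) (hDA : ∀ z ∈ D, z ∉ Q.A) (hDB : ∀ z ∈ D, z ∉ Q.B)
    {xL xR rB rT r₁ r₂ c₁ c₂ : ℤ} (hcols : xL + 2 ≤ xR) (hrows : rB + 3 ≤ rT)
    (hr₁ : r₁ ≤ rB) (hr₂ : rT ≤ r₂) (hc₁ : c₁ ≤ xL) (hc₂ : xR ≤ c₂)
    (hΛS : boxR xL xR r₁ r₂ ∪ boxR c₁ c₂ rB rT ⊆ Q.S) (hΛD : boxR xL xR r₁ r₂ ∪ boxR c₁ c₂ rB rT ⊆ D)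
    (hγΛ : ∀ v ∈ Q.γ k ω, planar k v ∈ D → planar k v ∈ boxR xL xR r₁ r₂ ∪ boxR c₁ c₂ rB rT)
    (htwo : ∃ x ∈ Q.γ k ω, ∃ y ∈ Q.γ k ω, x ≠ y ∧ planar k x ∈ D ∧ planar k y ∈ D)
    {w' q₁ cC : slab 3 k} (hadj : (slabGraph 3 k).Adj w' q₁) (hq₁D : planar k q₁ ∉ D)
    (hcC : cC ∈ slabLift k Q.C) (hσ : ω ∈ openConnIn (slabLift k (Q.R \ D)) q₁ cC)
    {n₁ n₂ m₁ m₂ : ℤ} (hNqD : boxR n₁ n₂ m₁ m₂ ⊆ D)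
    (hNqΛ : Disjoint (boxR n₁ n₂ m₁ m₂) (boxR xL xR r₁ r₂ ∪ boxR c₁ c₂ rB rT))
    (hw'N : planar k w' ∈ boxR n₁ n₂ m₁ m₂)
    (hside : (m₁ + 2 ≤ m₂ ∧ n₁ ≤ n₂ ∧ r₁ ≤ m₁ ∧ m₂ ≤ r₂ ∧ (xR + 1 = n₁ ∨ n₂ + 1 = xL)) ∨
      (n₁ + 2 ≤ n₂ ∧ m₁ ≤ m₂ ∧ c₁ ≤ n₁ ∧ n₂ ≤ c₂ ∧ (rT + 1 = m₁ ∨ m₂ + 1 = rB))) :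
    ∃ sx : Q.Surgery k ω, sx.D = D := by
  set Λ := boxR xL xR r₁ r₂ ∪ boxR c₁ c₂ rB rT with hΛ
  refine exists_surgery_of_route hX hDR hDA hDB hΛD hΛS htwo hadj hq₁D hcC hσ
    fun E₁ E₂ hE₁ hE₂ hne hE₁D hE₂D => ?_
  have hE₁Λ := hγΛ E₁ hE₁ hE₁D
  have hE₂Λ := hγΛ E₂ hE₂ hE₂D
  -- route lists over `Λ` miss the notch
  have missN : ∀ {L : List (slab 3 k)} {x : slab 3 k}, (∀ v ∈ L, planar k v ∈ Λ) →
      planar k x ∈ boxR n₁ n₂ m₁ m₂ → x ∉ L :=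
    fun hL hx hm => Set.disjoint_left.1 hNqΛ hx (hL _ hm)
  rcases hside with ⟨hm, hn, hrm₁, hrm₂, hxe⟩ | ⟨hn, hm, hcn₁, hcn₂, hye⟩
  · -- enter through the adjacent column of the vertical bar
    obtain ⟨e, X, hX, he1, he2, he3, hef₁, hef₂, -, hch, hXnd, hXlast, hXN⟩ :=
      exists_notch_chain_col (k := k) hm hn (xe := if xR + 1 = n₁ then xR else xL)
        (by rcases hxe with h | h
            · exact Or.inl (by rw [if_pos h]; omega)
            · by_cases h' : xR + 1 = n₁
              · exact Or.inl (by rw [if_pos h']; omega)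
              · exact Or.inr (by rw [if_neg h']; omega))
        hw'N (planar k E₁) (planar k E₂)
    have heΛ : planar k e ∈ Λ := by
      refine Or.inl ?_
      rw [mem_boxR_iff]
      refine ⟨?_, ?_, by omega, by omega⟩ <;> split_ifs at he1 <;> omega
    obtain ⟨L, Br, c, spec⟩ := exists_route_cross hk hcols hrows hr₁ hr₂ hc₁ hc₂ hE₁Λ hE₂Λ heΛ hne
      (fun h => hef₁ h.symm) (fun h => hef₂ h.symm)
    have spec' := RouteSpec.mono spec subset_rfl hΛD
    refine ⟨L, _, c, RouteSpec.append_branch X e Br hX spec' hch hXnd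
      (fun x hx => missN spec.hL_sub (hXN x hx))
      (fun x hx hm' => ?_) (fun x hx => hNqD (hXN x hx)) |> fun r => by rwa [hXlast] at r⟩
    rcases List.mem_cons.1 hm' with hm' | hm'
    · exact missN spec.hL_sub (hXN x hx) (hm' ▸ spec.hc)
    · exact missN spec.hBr_sub (hXN x hx) hm'
  · -- enter through the adjacent row of the horizontal bar
    obtain ⟨e, X, hX, he1, he2, he3, hef₁, hef₂, -, hch, hXnd, hXlast, hXN⟩ :=
      exists_notch_chain_row (k := k) hn hm (ye := if rT + 1 = m₁ then rT else rB)
        (by rcases hye with h | h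
            · exact Or.inl (by rw [if_pos h]; omega)
            · by_cases h' : rT + 1 = m₁
              · exact Or.inl (by rw [if_pos h']; omega)
              · exact Or.inr (by rw [if_neg h']; omega))
        hw'N (planar k E₁) (planar k E₂)
    have heΛ : planar k e ∈ Λ := by
      refine Or.inr ?_
      rw [mem_boxR_iff]
      refine ⟨by omega, by omega, ?_, ?_⟩ <;> split_ifs at he1 <;> omega
    obtain ⟨L, Br, c, spec⟩ := exists_route_cross hk hcols hrows hr₁ hr₂ hc₁ hc₂ hE₁Λ hE₂Λ heΛ hne
      (fun h => hef₁ h.symm) (fun h => hef₂ h.symm)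
    have spec' := RouteSpec.mono spec subset_rfl hΛD
    refine ⟨L, _, c, RouteSpec.append_branch X e Br hX spec' hch hXnd
      (fun x hx => missN spec.hL_sub (hXN x hx))
      (fun x hx hm' => ?_) (fun x hx => hNqD (hXN x hx)) |> fun r => by rwa [hXlast] at r⟩
    rcases List.mem_cons.1 hm' with hm' | hm'
    · exact missN spec.hL_sub (hXN x hx) (hm' ▸ spec.hc)
    · exact missN spec.hBr_sub (hXN x hx) hm'

end GlueData

end NTW17

end Literature.Probability.Percolation

end
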